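import Literature.Analysis.FluidPDE.CommutatorRemainder
import HarnessLib

/-!
# The commutator integral `H(x) = ∫ ∇K(x − y)[g(x) − g(y)] f(y) dy` is `C^{1,γ}` (Lemma 4.10)

Analysis/FluidPDE proofs file (no named facts) on the discharge path of Prop. 4.2
(`Literature.Analysis.FluidPDE.MajdaBertozzi2002_lagrangianField_lipschitzOn`). The Eulerian form
of the second part of the derivative of the particle-trajectory operator,
`G₂(X)Y ∘ X⁻¹(x) = ∫ ∇K₃(x − x')(Y(X⁻¹ x) − Y(X⁻¹ x')) f(x') dx'` (Majda–Bertozzi,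
*Vorticity and Incompressible Flow*, CUP 2002, §4.5 **Lemma 4.10**, (4.92)–(4.94), p. 145–146 of
the held text), is the integral `H(x) = ∫ ∇K(x − y)[g(x) − g(y)] f(y) dy` with `g = Y ∘ X⁻¹`.
Lemma 4.10 asserts `|G₂(X)Y|_{1,γ} ≤ c(M)‖ω₀‖_γ|Y|_{1,γ}` ((4.93)); its printed proof treats
`|·|₀` ((4.97)) and, for the Hölder norm of the derivative, refers to "the arguments from the
proof of Lemma 4.6 for a kernel of the type `∇ₓR(x, x')`". Here the estimate is **proved** by
the decomposition

`∇K(x − y)[g(x) − g(y)] f(y) = ∑_{i,m} Λ_{i,e_m}(x − y) (∂_i g_m(y) f(y)) + ∇K(x − y)[r(x, y)] f(y)`,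

`Λ_{i,e}(z) = z_i ∇K(z) e` (`stretchKernel`, `SingularKernelC3.lean`),
`r(x, y) = g(x) − g(y) − ∇g(y)(x − y)` (`taylorRem`): the nine convolution potentials of the
`C^γ_c` densities `∂_i g_m · f` are `C^{1,γ}` by the tree's Hölder theory of singular kernels
of degree `−2` (`contDiff_singularPotential`, `norm_fderiv_singularPotential_le`,
`holderWith_fderiv_singularPotential`, `SingularKernelGradient/Holder.lean`), and the remainder is
`C^{1,γ}` by `CommutatorRemainder.lean`. Main results:

* `commutatorIntegrand_eq_sum_add` / `commutatorPotential_eq` — the decomposition, pointwise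
  and after integration;
* `norm_singularPotential_le_of_support` — a sup bound for potentials of general `C¹` singular
  kernels (the tree had it for `K₃` only);
* `exists_commutator_bounds` — **Lemma 4.10 in Eulerian form**: for a `C³` singular kernel whose
  stretched kernels are `C³` singular kernels (the Biot–Savart kernel,
  `exists_isC3SingularKernel_biotSavart_family`), `0 < γ < 1`, and support/size data `C, R, M`
  of the density, there is `κ` such that for every multiplier `g` with `‖∇g‖ ≤ L₁` and
  `[∇g]_γ ≤ H` and every admissible density `f`, `H` is `C¹`, `‖H‖, ‖∇H‖ ≤ (L₁ + H)κ` and `∇H`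
  is `γ`-Hölder with constant `(L₁ + H)κ` — linear in `(L₁, H)`, hence in `|Y|_{1,γ}`
  downstream, as in (4.93).

## References

* A. J. Majda, A. L. Bertozzi, *Vorticity and Incompressible Flow* (CUP 2002), §4.1.3
  Prop. 4.2 and (4.41) (p. 128–130), §4.5 Lemma 4.10 (4.92)–(4.97) (p. 145–147).
  [MajdaBertozziCUP2002]
-/

set_option maxSynthPendingDepth 3

noncomputable section

open MeasureTheory Set Function Filter Metric Real
open _root_.Topology
open scoped NNReal ENNReal

namespace Literature.Analysis.FluidPDE

/-- Local notation for physical space `ℝ³ = EuclideanSpace ℝ (Fin 3)`. -/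
local notation "ℝ³" => EuclideanSpace ℝ (Fin 3)

variable {V W : Type*} [NormedAddCommGroup V] [NormedSpace ℝ V] [NormedAddCommGroup W]
  [NormedSpace ℝ W]

/-! ### The coefficient densities `∂_i g_m · f` -/

/-- The coefficient `∂_i g_m(y) = (∇g(y) e_i)_m`. [folklore] -/
theorem norm_fderiv_coord_le {g : ℝ³ → ℝ³} {L₁ : ℝ} (hL : ∀ y, ‖fderiv ℝ g y‖ ≤ L₁) (i m : Fin 3)
    (y : ℝ³) : |fderiv ℝ g y (EuclideanSpace.single i (1 : ℝ)) m| ≤ L₁ := by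
  have h1 : |fderiv ℝ g y (EuclideanSpace.single i (1 : ℝ)) m| ≤
      ‖fderiv ℝ g y (EuclideanSpace.single i (1 : ℝ))‖ := by
    rw [← Real.norm_eq_abs]; exact PiLp.norm_apply_le _ m
  refine h1.trans ((ContinuousLinearMap.le_opNorm _ _).trans ?_)
  have hn : ‖EuclideanSpace.single i (1 : ℝ)‖ = 1 := by simp
  rw [hn, mul_one]
  exact hL y

/-- Differences of the coefficient are controlled by `‖∇g(y) − ∇g(y')‖`. [folklore] -/
theorem abs_fderiv_coord_sub_le {g : ℝ³ → ℝ³} (i m : Fin 3) (y y' : ℝ³) :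
    |fderiv ℝ g y (EuclideanSpace.single i (1 : ℝ)) m - fderiv ℝ g y' (EuclideanSpace.single i (1 : ℝ)) m| ≤
      ‖fderiv ℝ g y - fderiv ℝ g y'‖ := by
  have h : fderiv ℝ g y (EuclideanSpace.single i (1 : ℝ)) m -
      fderiv ℝ g y' (EuclideanSpace.single i (1 : ℝ)) m =
      ((fderiv ℝ g y - fderiv ℝ g y') (EuclideanSpace.single i (1 : ℝ))) m := by
    rfl
  rw [h]
  have h1 : |((fderiv ℝ g y - fderiv ℝ g y') (EuclideanSpace.single i (1 : ℝ))) m| ≤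
      ‖(fderiv ℝ g y - fderiv ℝ g y') (EuclideanSpace.single i (1 : ℝ))‖ := by
    rw [← Real.norm_eq_abs]; exact PiLp.norm_apply_le _ m
  refine h1.trans ((ContinuousLinearMap.le_opNorm _ _).trans ?_)
  have hn : ‖EuclideanSpace.single i (1 : ℝ)‖ = 1 := by simp
  rw [hn, mul_one]

/-- **The coefficient density `y ↦ ∂_i g_m(y) • f(y)`.** [folklore] -/
def coeffDensity (g : ℝ³ → ℝ³) (f : ℝ³ → V) (i m : Fin 3) (y : ℝ³) : V :=
  fderiv ℝ g y (EuclideanSpace.single i (1 : ℝ)) m • f y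

section Coeff

variable {γ : ℝ≥0} {g : ℝ³ → ℝ³} {H L₁ : ℝ} {f : ℝ³ → V} {C : ℝ≥0} {c : ℝ³} {R M : ℝ}

/-- Sup bound `‖∂_i g_m f‖ ≤ L₁ M`. [folklore] -/
theorem norm_coeffDensity_le (hL : ∀ y, ‖fderiv ℝ g y‖ ≤ L₁) (hM : ∀ y, ‖f y‖ ≤ M) (i m : Fin 3)
    (y : ℝ³) : ‖coeffDensity g f i m y‖ ≤ L₁ * M := by
  have hL0 : 0 ≤ L₁ := (norm_nonneg _).trans (hL y)
  rw [coeffDensity, norm_smul, Real.norm_eq_abs]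
  exact mul_le_mul (norm_fderiv_coord_le hL i m y) (hM y) (norm_nonneg _) hL0

/-- The coefficient density is supported in the support of `f`. [folklore] -/
theorem tsupport_coeffDensity_subset (hsupp : tsupport f ⊆ closedBall c R) (i m : Fin 3) :
    tsupport (coeffDensity g f i m) ⊆ closedBall c R := by
  have h : support (coeffDensity g f i m) ⊆ support f := fun y hy => by
    contrapose! hy
    rw [notMem_support] at hy ⊢
    simp [coeffDensity, hy]
  exact (closure_mono h).trans hsupp

/-- The coefficient density has compact support. [folklore] -/
theorem hasCompactSupport_coeffDensity (hsupp : tsupport f ⊆ closedBall c R) (i m : Fin 3) :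
    HasCompactSupport (coeffDensity g f i m) :=
  hasCompactSupport_of_tsupport_subset (tsupport_coeffDensity_subset hsupp i m)

/-- **The coefficient density is `γ`-Hölder with constant `L₁ C + H M`** ((4.16)). [cite: MajdaBertozziCUP2002, §4.1.1 Lemma 4.1 (4.16) (p. 126)] -/
theorem holderWith_coeffDensity (hg : HolderGrad γ g H) (hL : ∀ y, ‖fderiv ℝ g y‖ ≤ L₁)
    (hf : HolderWith C γ f) (hM : ∀ y, ‖f y‖ ≤ M) (i m : Fin 3) :
    HolderWith (Real.toNNReal (L₁ * C + H * M)) γ (coeffDensity g f i m) := by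
  have hH := hg.nonneg
  have hM0 : 0 ≤ M := (norm_nonneg _).trans (hM 0)
  have hL0 : 0 ≤ L₁ := (norm_nonneg _).trans (hL 0)
  refine Literature.Analysis.FunctionSpaces.holderWith_of_dist_le fun y y' => ?_
  rw [dist_eq_norm, dist_eq_norm, Real.coe_toNNReal _ (by positivity)]
  have hsplit : coeffDensity g f i m y - coeffDensity g f i m y' =
      fderiv ℝ g y (EuclideanSpace.single i (1 : ℝ)) m • (f y - f y') +
        (fderiv ℝ g y (EuclideanSpace.single i (1 : ℝ)) m -
          fderiv ℝ g y' (EuclideanSpace.single i (1 : ℝ)) m) • f y' := by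
    simp only [coeffDensity, smul_sub, sub_smul]
    abel
  rw [hsplit]
  have hf' : ‖f y - f y'‖ ≤ C * ‖y - y'‖ ^ (γ : ℝ) := by
    rw [← dist_eq_norm, ← dist_eq_norm]; exact hf.dist_le y y'
  have e1 : ‖fderiv ℝ g y (EuclideanSpace.single i (1 : ℝ)) m • (f y - f y')‖ ≤ L₁ * (C * ‖y - y'‖ ^ (γ : ℝ)) := by
    rw [norm_smul, Real.norm_eq_abs]
    exact mul_le_mul (norm_fderiv_coord_le hL i m y) hf' (norm_nonneg _) hL0
  have e2 : ‖(fderiv ℝ g y (EuclideanSpace.single i (1 : ℝ)) m -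
      fderiv ℝ g y' (EuclideanSpace.single i (1 : ℝ)) m) • f y'‖ ≤ H * ‖y - y'‖ ^ (γ : ℝ) * M := by
    rw [norm_smul, Real.norm_eq_abs]
    exact mul_le_mul ((abs_fderiv_coord_sub_le i m y y').trans (hg.norm_sub_le y y')) (hM y')
      (norm_nonneg _) (by positivity)
  calc _ ≤ L₁ * (C * ‖y - y'‖ ^ (γ : ℝ)) + H * ‖y - y'‖ ^ (γ : ℝ) * M := norm_add_le_of_le e1 e2
    _ = (L₁ * C + H * M) * ‖y - y'‖ ^ (γ : ℝ) := by ring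

end Coeff

/-! ### A sup bound for potentials of general singular kernels -/

/-- `t^{1−3} = (t²)⁻¹` for `t ≥ 0` (both sides vanish at `0`). [folklore] -/
theorem rpow_one_sub_three (t : ℝ) (ht : 0 ≤ t) : t ^ ((1 : ℝ) - 3) = (t ^ 2)⁻¹ := by
  rcases ht.eq_or_lt with rfl | hpos
  · rw [Real.zero_rpow (by norm_num)]; simp
  · rw [show (1 : ℝ) - 3 = -((2 : ℕ) : ℝ) by norm_num, Real.rpow_neg hpos.le, Real.rpow_natCast]

/-- **Sup bound for the potential of a `C¹` singular kernel** of a density supported in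
`B̄(c, R)` and bounded by `M`: `‖∫ K(x − y) f(y) dy‖ ≤ A M (8πR + (2R)^{−2}(4/3)πR³)` for all `x`
(Majda–Bertozzi Lemma 4.5, `|K_N f|₀ ≤ cR|f|₀`, for a general kernel of degree `−2`). [cite: MajdaBertozziCUP2002, §4.1.3 Lemma 4.5 (4.34) (p. 128)] -/
theorem norm_singularPotential_le_of_support {K : ℝ³ → V →L[ℝ] W} {A : ℝ} (hK : IsC1SingularKernel K A)
    {f : ℝ³ → V} {c : ℝ³} {R M : ℝ} (hR : 0 < R) (hsupp : tsupport f ⊆ closedBall c R)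
    (hM : ∀ y, ‖f y‖ ≤ M) (x : ℝ³) :
    ‖singularPotential K f x‖ ≤
      A * M * (4 * π * (2 * R) ^ (1 : ℝ) / 1 + (2 * R) ^ ((1 : ℝ) - 3) * (4 / 3 * π * R ^ 3)) := by
  have hA := hK.nonneg
  have hM0 : 0 ≤ M := (norm_nonneg _).trans (hM x)
  refine norm_integral_le_of_le_majorant (mul_nonneg hA hM0) (by positivity)
    (le_of_eq (lintegral_majorant_support c hR one_pos x)) fun y => ?_
  have h2 := norm_mul_rpow_le_majorant hR hsupp hM (s := (1 : ℝ)) (by norm_num) x y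
  calc ‖K (x - y) (f y)‖ ≤ ‖K (x - y)‖ * ‖f y‖ := ContinuousLinearMap.le_opNorm _ _
    _ ≤ A * (‖x - y‖ ^ 2)⁻¹ * ‖f y‖ := by gcongr; exact hK.norm_le _
    _ = A * (‖f y‖ * ‖x - y‖ ^ ((1 : ℝ) - 3)) := by rw [rpow_one_sub_three _ (norm_nonneg _)]; ring
    _ ≤ A * (M * _) := by gcongr
    _ = _ := by ring

/-! ### The decomposition of the commutator integrand -/

section Decomposition

variable {K : ℝ³ → V →L[ℝ] W}

/-- **Expansion in the standard basis**: for linear `P : ℝ³ → (V → W)` and `Lg : ℝ³ → ℝ³`,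
`P(Lg z) v = ∑_{i,m} (z_i (Lg e_i)_m) • P(e_m) v`. [folklore] -/
theorem clm_apply_clm_eq_sum (P : ℝ³ →L[ℝ] V →L[ℝ] W) (Lg : ℝ³ →L[ℝ] ℝ³) (z : ℝ³) (v : V) :
    P (Lg z) v = ∑ p : Fin 3 × Fin 3,
      (z p.1 * Lg (EuclideanSpace.single p.1 (1 : ℝ)) p.2) • P (EuclideanSpace.single p.2 (1 : ℝ)) v := by
  have hz : Lg z = ∑ i : Fin 3, z i • Lg (EuclideanSpace.single i (1 : ℝ)) := by
    conv_lhs => rw [← (EuclideanSpace.basisFun (Fin 3) ℝ).sum_repr z]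
    simp only [map_sum, map_smul, EuclideanSpace.basisFun_repr, EuclideanSpace.basisFun_apply]
  have hw : ∀ w : ℝ³, w = ∑ m : Fin 3, w m • EuclideanSpace.single m (1 : ℝ) := fun w => by
    conv_lhs => rw [← (EuclideanSpace.basisFun (Fin 3) ℝ).sum_repr w]
    simp only [EuclideanSpace.basisFun_repr, EuclideanSpace.basisFun_apply]
  have hz2 : Lg z = ∑ i : Fin 3, ∑ m : Fin 3,
      (z i * Lg (EuclideanSpace.single i (1 : ℝ)) m) • EuclideanSpace.single m (1 : ℝ) := by
    rw [hz]
    refine Finset.sum_congr rfl fun i _ => ?_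
    conv_lhs => rw [hw (Lg (EuclideanSpace.single i (1 : ℝ)))]
    rw [Finset.smul_sum]
    refine Finset.sum_congr rfl fun m _ => ?_
    rw [smul_smul]
  have hsum : ∀ (s : Finset (Fin 3)) (T : Fin 3 → V →L[ℝ] W), (∑ j ∈ s, T j) v = ∑ j ∈ s, T j v :=
    fun s T => map_sum (ContinuousLinearMap.apply ℝ W v) T s
  rw [hz2, map_sum, hsum, Fintype.sum_prod_type]
  refine Finset.sum_congr rfl fun i _ => ?_
  rw [map_sum, hsum]
  refine Finset.sum_congr rfl fun m _ => ?_
  rw [map_smul]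
  rfl

/-- **The commutator integrand** `∇K(x − y)[g(x) − g(y)] f(y)`. [cite: MajdaBertozziCUP2002, §4.5 Lemma 4.10 (4.94) (p. 146)] -/
def commutatorIntegrand (K : ℝ³ → V →L[ℝ] W) (g : ℝ³ → ℝ³) (f : ℝ³ → V) (x y : ℝ³) : W :=
  fderiv ℝ K (x - y) (g x - g y) (f y)

/-- **The commutator integral** `H(x) = ∫ ∇K(x − y)[g(x) − g(y)] f(y) dy`
(`= G₂(X)Y ∘ X⁻¹`, (4.94)). [cite: MajdaBertozziCUP2002, §4.5 Lemma 4.10 (4.94) (p. 146)] -/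
def commutatorPotential (K : ℝ³ → V →L[ℝ] W) (g : ℝ³ → ℝ³) (f : ℝ³ → V) (x : ℝ³) : W :=
  ∫ y, commutatorIntegrand K g f x y

/-- **The pointwise decomposition**:
`∇K(x−y)[g x − g y] f y = ∑_{i,m} Λ_{i,e_m}(x − y)(∂_i g_m(y) f y) + ∇K(x − y)[r(x, y)] f y`. [folklore] -/
theorem commutatorIntegrand_eq_sum_add (g : ℝ³ → ℝ³) (f : ℝ³ → V) (x y : ℝ³) :
    commutatorIntegrand K g f x y =
      (∑ p : Fin 3 × Fin 3, stretchKernel K p.1 (EuclideanSpace.single p.2 (1 : ℝ)) (x - y)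
        (coeffDensity g f p.1 p.2 y)) + remIntegrand K g f x y := by
  have hsplit : g x - g y = fderiv ℝ g y (x - y) + taylorRem g x y := by
    rw [taylorRem]; abel
  rw [commutatorIntegrand, hsplit, map_add, add_apply, remIntegrand, add_left_inj,
    clm_apply_clm_eq_sum (fderiv ℝ K (x - y)) (fderiv ℝ g y) (x - y) (f y)]
  refine Finset.sum_congr rfl fun p _ => ?_
  rw [stretchKernel_apply, coeffDensity, map_smul, smul_smul]

end Decomposition

/-! ### Lemma 4.10 in Eulerian form -/

section Bounds

variable {K : ℝ³ → V →L[ℝ] W} {A : ℝ} {γ : ℝ≥0}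

/-- **The decomposition after integration**: `H = ∑_{i,m} (Λ_{i,e_m} potential of ∂_i g_m f) + Rem`. [folklore] -/
theorem commutatorPotential_eq (hK : IsC3SingularKernel K A)
    (hΛ : ∀ i m : Fin 3, IsC3SingularKernel (stretchKernel K i (EuclideanSpace.single m (1 : ℝ))) A)
    (hγ : 0 < γ) (hγ1 : (γ : ℝ) < 1) {g : ℝ³ → ℝ³} {H L₁ : ℝ} (hg : HolderGrad γ g H)
    (hL : ∀ y, ‖fderiv ℝ g y‖ ≤ L₁) {f : ℝ³ → V} {C : ℝ≥0} {c : ℝ³} {R M : ℝ} (hf : HolderWith C γ f)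
    (hR : 0 < R) (hsupp : tsupport f ⊆ closedBall c R) (hM : ∀ y, ‖f y‖ ≤ M) :
    commutatorPotential K g f = fun x =>
      (∑ p : Fin 3 × Fin 3, singularPotential (stretchKernel K p.1 (EuclideanSpace.single p.2 (1 : ℝ)))
        (coeffDensity g f p.1 p.2) x) + remPotential K g f x := by
  funext x
  have hfcont : Continuous f := hf.continuous hγ
  have hφc : ∀ p : Fin 3 × Fin 3, Continuous (coeffDensity g f p.1 p.2) := fun p =>
    (holderWith_coeffDensity hg hL hf hM p.1 p.2).continuous hγ
  have hφs : ∀ p : Fin 3 × Fin 3, HasCompactSupport (coeffDensity g f p.1 p.2) := fun p =>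
    hasCompactSupport_coeffDensity hsupp p.1 p.2
  have hint : ∀ p ∈ (Finset.univ : Finset (Fin 3 × Fin 3)), Integrable fun y =>
      stretchKernel K p.1 (EuclideanSpace.single p.2 (1 : ℝ)) (x - y) (coeffDensity g f p.1 p.2 y) :=
    fun p _ => integrable_kernel_sub_apply (hΛ p.1 p.2).toIsC1SingularKernel (hφc p) (hφs p) x
  have hrem := integrable_remIntegrand hK hg hγ hγ1 hfcont hR hsupp hM x
  simp only [commutatorPotential, commutatorIntegrand_eq_sum_add]
  rw [integral_add (integrable_finsetSum _ hint) hrem, integral_finsetSum _ hint]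
  rfl

set_option maxHeartbeats 800000 in
/-- **Lemma 4.10 (Eulerian form): the commutator integral is `C^{1,γ}` with bounds linear in
the multiplier.** For a `C³` singular kernel `K` whose stretched kernels are `C³` singular
kernels with the same constant, `0 < γ < 1`, a Hölder constant `C`, a support radius `R > 0` and
a sup bound `M ≥ 0`, there is `κ ≥ 0` such that: for every multiplier `g` with `‖∇g‖ ≤ L₁`,
`[∇g]_γ ≤ H` and every `γ`-Hölder (`C`) density `f` supported in some `B̄(c, R)` and bounded by
`M`, the integral `H(x) = ∫ ∇K(x − y)[g x − g y] f(y) dy` is `C¹`, `‖H(x)‖ ≤ (L₁ + H)κ`,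
`‖∇H(x)‖ ≤ (L₁ + H)κ`, and `‖∇H(x) − ∇H(x̄)‖ ≤ (L₁ + H)κ|x − x̄|^γ`
(Majda–Bertozzi (4.93): `|G₂(X)Y|_{1,γ} ≤ c(M)‖ω₀‖_γ|Y|_{1,γ}`). [cite: MajdaBertozziCUP2002, §4.5 Lemma 4.10 (4.93) (p. 145–147) and §4.1.3 (4.41) (p. 130)] -/
theorem exists_commutator_bounds [CompleteSpace W] (hK : IsC3SingularKernel K A)
    (hΛ : ∀ i m : Fin 3, IsC3SingularKernel (stretchKernel K i (EuclideanSpace.single m (1 : ℝ))) A)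
    (hγ : 0 < γ) (hγ1 : (γ : ℝ) < 1) (C : ℝ≥0) {R M : ℝ} (hR : 0 < R) (hM0 : 0 ≤ M) :
    ∃ κ : ℝ, 0 ≤ κ ∧ ∀ (g : ℝ³ → ℝ³) (H L₁ : ℝ), HolderGrad γ g H → (∀ y, ‖fderiv ℝ g y‖ ≤ L₁) →
      ∀ (f : ℝ³ → V) (c : ℝ³), HolderWith C γ f → tsupport f ⊆ closedBall c R → (∀ y, ‖f y‖ ≤ M) →
        ContDiff ℝ 1 (commutatorPotential K g f) ∧
        (∀ x, ‖commutatorPotential K g f x‖ ≤ (L₁ + H) * κ) ∧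
        (∀ x, ‖fderiv ℝ (commutatorPotential K g f) x‖ ≤ (L₁ + H) * κ) ∧
        ∀ x x', ‖fderiv ℝ (commutatorPotential K g f) x - fderiv ℝ (commutatorPotential K g f) x'‖ ≤
          (L₁ + H) * κ * ‖x - x'‖ ^ (γ : ℝ) := by
  obtain ⟨B, hB0, hB⟩ := exists_norm_fderiv_radialCutoff_le
  have hA := hK.nonneg
  have hγ' : (0 : ℝ) < γ := by exact_mod_cast hγ
  have h1γ : (0 : ℝ) < 1 - γ := by linarith
  -- constants of the nine convolution potentials, per unit `(L₁ + H)`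
  set κa : ℝ := A * M * (4 * π * (2 * R) ^ (1 : ℝ) / 1 + (2 * R) ^ ((1 : ℝ) - 3) * (4 / 3 * π * R ^ 3))
    with hκa
  set κb : ℝ := A * (C + M) * (4 * π * (8 * R) ^ (γ : ℝ) / γ) + 256 * π / 3 * A * M +
    128 * π / 3 * A * B * M with hκb
  set κd : ℝ := holderGradConstC A B γ * (C + M) + holderGradConstM A B * M * (R ^ (γ : ℝ))⁻¹ with hκd
  -- constants of the remainder, per unit `H`
  set ρa : ℝ := A * M * (4 * π * (2 * R) ^ ((γ : ℝ) + 1) / ((γ : ℝ) + 1) +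
    (2 * R) ^ ((γ : ℝ) + 1 - 3) * (4 / 3 * π * R ^ 3)) with hρa
  set ρb : ℝ := 2 * A * M * (4 * π * (2 * R) ^ (γ : ℝ) / (γ : ℝ) + (2 * R) ^ ((γ : ℝ) - 3) * (4 / 3 * π * R ^ 3))
    with hρb
  set ρd : ℝ := remHolderConst A B C M R γ with hρd
  have hκa0 : 0 ≤ κa := by positivity
  have hκb0 : 0 ≤ κb := by positivity
  have hGC := holderGradConstC_nonneg hA hB0 hγ' hγ1
  have hGM := holderGradConstM_nonneg hA hB0
  have hκd0 : 0 ≤ κd := by positivity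
  have hρa0 : 0 ≤ ρa := by positivity
  have hρb0 : 0 ≤ ρb := by positivity
  have hρd0 : 0 ≤ ρd := remHolderConst_nonneg hA hB0 hM0 hR.le hγ' hγ1
  refine ⟨9 * (κa + κb + κd) + (ρa + ρb + ρd), by positivity, ?_⟩
  intro g H L₁ hg hL f c hf hsupp hM
  have hH := hg.nonneg
  have hL0 : 0 ≤ L₁ := (norm_nonneg _).trans (hL 0)
  have hfcont : Continuous f := hf.continuous hγ
  -- the nine densities
  set Λ : Fin 3 × Fin 3 → ℝ³ → V →L[ℝ] W := fun p => stretchKernel K p.1 (EuclideanSpace.single p.2 (1 : ℝ))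
    with hΛdef
  set φ : Fin 3 × Fin 3 → ℝ³ → V := fun p => coeffDensity g f p.1 p.2 with hφdef
  have hΛp : ∀ p, IsC3SingularKernel (Λ p) A := fun p => hΛ p.1 p.2
  have hφH : ∀ p, HolderWith (Real.toNNReal (L₁ * C + H * M)) γ (φ p) := fun p =>
    holderWith_coeffDensity hg hL hf hM p.1 p.2
  have hφsupp : ∀ p, tsupport (φ p) ⊆ closedBall c R := fun p => tsupport_coeffDensity_subset hsupp p.1 p.2
  have hφM : ∀ p y, ‖φ p y‖ ≤ L₁ * M := fun p y => norm_coeffDensity_le hL hM p.1 p.2 y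
  have hφc : ∀ p, HasCompactSupport (φ p) := fun p => hasCompactSupport_coeffDensity hsupp p.1 p.2
  have hCφ : (Real.toNNReal (L₁ * C + H * M) : ℝ) = L₁ * C + H * M := Real.coe_toNNReal _ (by positivity)
  -- bounds for each convolution potential
  set P : Fin 3 × Fin 3 → ℝ³ → W := fun p => singularPotential (Λ p) (φ p) with hPdef
  have hPcd : ∀ p, ContDiff ℝ 1 (P p) := fun p =>
    contDiff_singularPotential (hΛp p).toIsC1SingularKernel hγ (hφH p) (hφc p)
  have hP0 : ∀ p x, ‖P p x‖ ≤ (L₁ + H) * κa := by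
    intro p x
    refine (norm_singularPotential_le_of_support (hΛp p).toIsC1SingularKernel hR (hφsupp p) (hφM p) x).trans ?_
    rw [hκa]
    have : A * (L₁ * M) ≤ (L₁ + H) * (A * M) := by
      calc A * (L₁ * M) = L₁ * (A * M) := by ring
        _ ≤ (L₁ + H) * (A * M) := by gcongr; linarith
    calc A * (L₁ * M) * _ ≤ (L₁ + H) * (A * M) * _ := by gcongr
      _ = _ := by ring
  have hP1 : ∀ p x, ‖fderiv ℝ (P p) x‖ ≤ (L₁ + H) * κb := by
    intro p x
    refine (norm_fderiv_singularPotential_le (hΛp p).toIsC1SingularKernel hB0 hB hγ (hφH p) hR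
      (hφsupp p) (hφM p) x).trans ?_
    rw [hCφ, hκb]
    have e1 : L₁ * C + H * M ≤ (L₁ + H) * (C + M) := by
      have h0 : 0 ≤ L₁ * M + H * (C : ℝ) := by positivity
      linarith [show (L₁ + H) * ((C : ℝ) + M) = L₁ * C + H * M + (L₁ * M + H * C) by ring]
    have e2 : L₁ * M ≤ (L₁ + H) * M := by
      have h0 : 0 ≤ H * M := by positivity
      linarith [show (L₁ + H) * M = L₁ * M + H * M by ring]
    calc A * (L₁ * C + H * M) * (4 * π * (8 * R) ^ (γ : ℝ) / γ) + 256 * π / 3 * A * (L₁ * M) +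
          128 * π / 3 * A * B * (L₁ * M)
        ≤ A * ((L₁ + H) * (C + M)) * (4 * π * (8 * R) ^ (γ : ℝ) / γ) + 256 * π / 3 * A * ((L₁ + H) * M) +
          128 * π / 3 * A * B * ((L₁ + H) * M) := by gcongr
      _ = _ := by ring
  have hP2 : ∀ p x x', ‖fderiv ℝ (P p) x - fderiv ℝ (P p) x'‖ ≤ (L₁ + H) * κd * ‖x - x'‖ ^ (γ : ℝ) := by
    intro p x x'
    have h := (holderWith_fderiv_singularPotential (hΛp p).isC2 hB0 hB hγ hγ1 (hφH p) hR (hφsupp p)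
      (hφM p)).dist_le x x'
    rw [dist_eq_norm, dist_eq_norm, hCφ] at h
    have hc0 : 0 ≤ holderGradConstC A B γ * (L₁ * C + H * M) + holderGradConstM A B * (L₁ * M) * (R ^ (γ : ℝ))⁻¹ := by
      positivity
    rw [Real.coe_toNNReal _ hc0] at h
    refine h.trans ?_
    gcongr
    rw [hκd]
    have e1 : L₁ * C + H * M ≤ (L₁ + H) * (C + M) := by
      have h0 : 0 ≤ L₁ * M + H * (C : ℝ) := by positivity
      linarith [show (L₁ + H) * ((C : ℝ) + M) = L₁ * C + H * M + (L₁ * M + H * C) by ring]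
    have e2 : L₁ * M ≤ (L₁ + H) * M := by
      have h0 : 0 ≤ H * M := by positivity
      linarith [show (L₁ + H) * M = L₁ * M + H * M by ring]
    calc holderGradConstC A B γ * (L₁ * C + H * M) + holderGradConstM A B * (L₁ * M) * (R ^ (γ : ℝ))⁻¹
        ≤ holderGradConstC A B γ * ((L₁ + H) * (C + M)) + holderGradConstM A B * ((L₁ + H) * M) * (R ^ (γ : ℝ))⁻¹ := by
          gcongr
      _ = _ := by ring
  -- bounds for the remainder
  have hR0 : ∀ x, ‖remPotential K g f x‖ ≤ (L₁ + H) * ρa := by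
    intro x
    refine (norm_remPotential_le hK.toIsC1SingularKernel hg hγ hγ1 hR hsupp hM x).trans ?_
    rw [hρa]
    have : A * H * M ≤ (L₁ + H) * (A * M) := by
      calc A * H * M = H * (A * M) := by ring
        _ ≤ (L₁ + H) * (A * M) := by gcongr; linarith
    calc A * H * M * _ ≤ (L₁ + H) * (A * M) * _ := by gcongr
      _ = _ := by ring
  have hR1 : ∀ x, ‖remGrad K g f x‖ ≤ (L₁ + H) * ρb := by
    intro x
    refine (norm_remGrad_le hK hg hγ hγ1 hR hsupp hM x).trans ?_
    rw [hρb]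
    have : 2 * A * H * M ≤ (L₁ + H) * (2 * A * M) := by
      calc 2 * A * H * M = H * (2 * A * M) := by ring
        _ ≤ (L₁ + H) * (2 * A * M) := by gcongr; linarith
    calc 2 * A * H * M * _ ≤ (L₁ + H) * (2 * A * M) * _ := by gcongr
      _ = _ := by ring
  have hR2 : ∀ x x', ‖remGrad K g f x - remGrad K g f x'‖ ≤ (L₁ + H) * ρd * ‖x - x'‖ ^ (γ : ℝ) := by
    intro x x'
    refine (norm_remGrad_sub_le hK hB0 hB hγ hγ1 hg hf hR hsupp hM x x').trans ?_
    gcongr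
    linarith
  have hRfd := fderiv_remPotential hK hg hγ hγ1 hfcont hR hsupp hM
  have hRcd : ContDiff ℝ 1 (remPotential K g f) := by
    rw [contDiff_one_iff_fderiv]
    refine ⟨differentiable_remPotential hK hg hγ hγ1 hfcont hR hsupp hM, ?_⟩
    rw [hRfd]
    have hhol : HolderWith (Real.toNNReal ((L₁ + H) * ρd)) γ (remGrad K g f) := by
      refine Literature.Analysis.FunctionSpaces.holderWith_of_dist_le fun x x' => ?_
      rw [dist_eq_norm, dist_eq_norm, Real.coe_toNNReal _ (by positivity)]
      exact hR2 x x'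
    exact hhol.continuous hγ
  -- the decomposition
  have hdec := commutatorPotential_eq hK hΛ hγ hγ1 hg hL hf hR hsupp hM
  have hdec' : commutatorPotential K g f = fun x => (∑ p : Fin 3 × Fin 3, P p x) + remPotential K g f x := hdec
  have hcd : ContDiff ℝ 1 (commutatorPotential K g f) := by
    rw [hdec']
    exact (ContDiff.sum fun p _ => hPcd p).add hRcd
  have hderiv : ∀ x, HasFDerivAt (commutatorPotential K g f)
      ((∑ p : Fin 3 × Fin 3, fderiv ℝ (P p) x) + remGrad K g f x) x := by
    intro x
    rw [hdec']
    refine (HasFDerivAt.fun_sum fun p _ => ((hPcd p).differentiable one_ne_zero x).hasFDerivAt).add ?_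
    exact hasFDerivAt_remPotential hK hg hγ hγ1 hfcont hR hsupp hM x
  have hfd : ∀ x, fderiv ℝ (commutatorPotential K g f) x =
      (∑ p : Fin 3 × Fin 3, fderiv ℝ (P p) x) + remGrad K g f x := fun x => (hderiv x).fderiv
  have hcard : (Finset.univ : Finset (Fin 3 × Fin 3)).card = 9 := by simp
  refine ⟨hcd, fun x => ?_, fun x => ?_, fun x x' => ?_⟩
  · rw [hdec']
    calc ‖(∑ p : Fin 3 × Fin 3, P p x) + remPotential K g f x‖
        ≤ ‖∑ p : Fin 3 × Fin 3, P p x‖ + ‖remPotential K g f x‖ := norm_add_le _ _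
      _ ≤ (∑ p : Fin 3 × Fin 3, ‖P p x‖) + (L₁ + H) * ρa := add_le_add (norm_sum_le _ _) (hR0 x)
      _ ≤ (∑ _p : Fin 3 × Fin 3, (L₁ + H) * κa) + (L₁ + H) * ρa := by
          gcongr with p _; exact hP0 p x
      _ = 9 * ((L₁ + H) * κa) + (L₁ + H) * ρa := by rw [Finset.sum_const, hcard]; simp
      _ ≤ (L₁ + H) * (9 * (κa + κb + κd) + (ρa + ρb + ρd)) := by
          have hx : 0 ≤ (L₁ + H) * (9 * κb + 9 * κd + ρb + ρd) := by positivity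
          linarith [show (L₁ + H) * (9 * (κa + κb + κd) + (ρa + ρb + ρd)) =
            9 * ((L₁ + H) * κa) + (L₁ + H) * ρa + (L₁ + H) * (9 * κb + 9 * κd + ρb + ρd) by ring]
  · rw [hfd x]
    calc ‖(∑ p : Fin 3 × Fin 3, fderiv ℝ (P p) x) + remGrad K g f x‖
        ≤ ‖∑ p : Fin 3 × Fin 3, fderiv ℝ (P p) x‖ + ‖remGrad K g f x‖ := norm_add_le _ _
      _ ≤ (∑ p : Fin 3 × Fin 3, ‖fderiv ℝ (P p) x‖) + (L₁ + H) * ρb := add_le_add (norm_sum_le _ _) (hR1 x)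
      _ ≤ (∑ _p : Fin 3 × Fin 3, (L₁ + H) * κb) + (L₁ + H) * ρb := by
          gcongr with p _; exact hP1 p x
      _ = 9 * ((L₁ + H) * κb) + (L₁ + H) * ρb := by rw [Finset.sum_const, hcard]; simp
      _ ≤ (L₁ + H) * (9 * (κa + κb + κd) + (ρa + ρb + ρd)) := by
          have hx : 0 ≤ (L₁ + H) * (9 * κa + 9 * κd + ρa + ρd) := by positivity
          linarith [show (L₁ + H) * (9 * (κa + κb + κd) + (ρa + ρb + ρd)) =
            9 * ((L₁ + H) * κb) + (L₁ + H) * ρb + (L₁ + H) * (9 * κa + 9 * κd + ρa + ρd) by ring]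
  · rw [hfd x, hfd x']
    have hsplit : (∑ p : Fin 3 × Fin 3, fderiv ℝ (P p) x) + remGrad K g f x -
        ((∑ p : Fin 3 × Fin 3, fderiv ℝ (P p) x') + remGrad K g f x') =
        (∑ p : Fin 3 × Fin 3, (fderiv ℝ (P p) x - fderiv ℝ (P p) x')) +
          (remGrad K g f x - remGrad K g f x') := by
      rw [Finset.sum_sub_distrib]; abel
    rw [hsplit]
    have hδ : 0 ≤ ‖x - x'‖ ^ (γ : ℝ) := by positivity
    calc ‖(∑ p : Fin 3 × Fin 3, (fderiv ℝ (P p) x - fderiv ℝ (P p) x')) + (remGrad K g f x - remGrad K g f x')‖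
        ≤ ‖∑ p : Fin 3 × Fin 3, (fderiv ℝ (P p) x - fderiv ℝ (P p) x')‖ + ‖remGrad K g f x - remGrad K g f x'‖ :=
          norm_add_le _ _
      _ ≤ (∑ p : Fin 3 × Fin 3, ‖fderiv ℝ (P p) x - fderiv ℝ (P p) x'‖) + (L₁ + H) * ρd * ‖x - x'‖ ^ (γ : ℝ) :=
          add_le_add (norm_sum_le _ _) (hR2 x x')
      _ ≤ (∑ _p : Fin 3 × Fin 3, (L₁ + H) * κd * ‖x - x'‖ ^ (γ : ℝ)) + (L₁ + H) * ρd * ‖x - x'‖ ^ (γ : ℝ) := by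
          gcongr with p _; exact hP2 p x x'
      _ = 9 * ((L₁ + H) * κd * ‖x - x'‖ ^ (γ : ℝ)) + (L₁ + H) * ρd * ‖x - x'‖ ^ (γ : ℝ) := by
          rw [Finset.sum_const, hcard]; simp
      _ ≤ (L₁ + H) * (9 * (κa + κb + κd) + (ρa + ρb + ρd)) * ‖x - x'‖ ^ (γ : ℝ) := by
          have hx : 0 ≤ (L₁ + H) * (9 * κa + 9 * κb + ρa + ρb) * ‖x - x'‖ ^ (γ : ℝ) := by positivity
          linarith [show (L₁ + H) * (9 * (κa + κb + κd) + (ρa + ρb + ρd)) * ‖x - x'‖ ^ (γ : ℝ) =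
            9 * ((L₁ + H) * κd * ‖x - x'‖ ^ (γ : ℝ)) + (L₁ + H) * ρd * ‖x - x'‖ ^ (γ : ℝ) +
              (L₁ + H) * (9 * κa + 9 * κb + ρa + ρb) * ‖x - x'‖ ^ (γ : ℝ) by ring]

end Bounds

end Literature.Analysis.FluidPDE
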